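import Literature.AlgebraicGeometry.Motives.PeriodComparison
import Literature.AlgebraicGeometry.Motives.BettiCycleClass
import Literature.AlgebraicGeometry.HodgeTheory.RealStructureSingular
import Literature.AlgebraicGeometry.HodgeTheory.HodgeConjecture
import Literature.AlgebraicGeometry.HodgeTheory.HodgeFiltration
import Literature.AlgebraicGeometry.Motives.BettiHodgeClassicalPin
import HarnessLib

/-!
# Classical Betti–Hodge data and classical period realizations (hypothesis predicates)

`BettiHodgeData ℂ` (`Motives/BettiRealization`) and `PeriodRealization k` (`Motives/PeriodComparison`)
are HYPOTHESIS STRUCTURES standing in for the classical Betti–Hodge realization and Grothendieck's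
de Rham–Betti comparison. Their axioms do not determine the data: the tree records three "exotic"
re-decorations of any datum `B` satisfying every field of `BettiHodgeData` — Weil's two-type
structures in odd degree (`BettiHodgeData.weil`, `Motives/BettiRealizationWeil`), structures purely of
type `(p,p)` in even degree (`BettiHodgeData.pureEven`, `Motives/BettiRealizationPure`), conjugate
structures (`BettiHodgeData.conjugate`, `Motives/Sweep1HodgeRiemannConjugate`). Hence, as for
`NoriMotivicInterface` (junk-instance warning, `Motives/NoriInterface`), every bridge between the
abstract layer (`B.hodge`, `B.HodgeConjectureFor`, `P.iso`, …) and the real carriers of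
`Literature/AlgebraicGeometry/HodgeTheory` (singular cohomology of complex points, Hodge models,
`HodgeTheory.HodgeConjectureFor`) must be stated under a HYPOTHESIS PREDICATE tying the datum to the
classical one — never for all data. This file defines it (definition request
`defn-PeriodRealization.IsClassical`, routes `HodgeConjecture/PeriodsPolice`, `…/AttractorPlanes`;
v1 = clauses (i)+(ii) of the request) and proves the bridge it was requested for.

* `BettiHodgeData.IsClassical B` (`B : BettiHodgeData ℂ`), a `Prop`-valued structure:
  - **(i) `B.hodge` is the Hodge structure of `X^an`** (`comap_hodgePQ`, `comap_hodgeFiltration`).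
    For `X` smooth projective of dimension `n`, every Hodge model `A : HodgeTheory.HodgeModel n X`
    (analytification + natural de Rham comparison + Hodge decomposition) and the comparison
    `Φ_A = B.hodgeModelComparison A i : ℂ ⊗_ℚ Hⁱ(X) → ℂ ⊗_ℚ Hⁱ(X(ℂ); ℚ) → Hⁱ(X(ℂ); ℂ) → Hⁱ(X^an; ℂ)`
    (`B.iso ⊗ ℂ`, the change of coefficients `HodgeTheory.ofRatClass` extended `ℂ`-linearly, the
    pull-back `A.pullback` along `X^an → X(ℂ)`): `V^{p,q} = Φ_A⁻¹(H^{p,q}(X^an))` for `p + q = i` and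
    `Fʳ = Φ_A⁻¹(Fʳ Hⁱ(X^an))` — both of Voisin's equivalent descriptions of THE Hodge structure of
    weight `i` on `Hⁱ(X, ℤ)` of a compact Kähler manifold (Voisin, *Hodge Theory I*, §6.1.3
    Prop. 6.11, §7.1.1 Def. 7.4: `V_ℂ = ⊕ V^{p,q}`, `Fᵖ = ⊕_{r ≥ p} V^{r,k-r}`, `V^{p,q} = Fᵖ ∩ conj F^q`;
    Deligne 2000, §1), recorded in both forms so that consumers need neither universal
    coefficients nor Hodge symmetry of the model to pass between them.
  - **(ii-a) cycle classes are supported on their cycles** (`restrictCompl_cycleClass`). For `z` of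
    codimension `p` on smooth projective `X`, `B.iso (cl(z̄)) ∈ H²ᵖ(X(ℂ); ℚ)` restricts to `0` on
    `(X ∖ z̄)(ℂ)`: the topological class of `Z = z̄` is by definition the image of a class of
    `H²ᵖ(X, X ∖ Z)` (Voisin I, §11.1.2, `[Z] = j_Z(T⁻¹(1))`; Fulton, *Intersection Theory*, §19.1).
  - **(ii-b) integral structure, fundamental classes, trace** (`exists_bettiCycleData`). `B` extends
    to a `BettiCycleData` (`Motives/BettiCycleClass`): integral structure `Hⁱ(X(ℂ); ℤ) → Hⁱ(X(ℂ); ℚ)`,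
    orientations of the closed manifolds `X(ℂ)` for which `tr_X` is evaluation on `[X(ℂ)]`, integral
    cycle classes refining the rational ones with `cl_ℤ[Z] ⌢ [X(ℂ)] = ι_*[Z(ℂ)]` for smooth `Z ⊆ X`
    (Voisin I, §11.1.2; Fulton §19.1; Hatcher §3.3).
* `PeriodRealization.IsClassical P` (`P : PeriodRealization k`): `P.B.IsClassical`.
* Proved API: membership forms; `mem_hodgeClasses_iff_isOfHodgeType` /
  `…_iff_isInHodgeFiltration` (Hodge classes of `B.hodge` = rational `(p,p)`- / `Fᵖ`-classes of the
  real carrier); `ofRatClass_isoObj_cycleClass_mem` (Betti cycle classes lie in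
  `HodgeTheory.algebraicClasses = Nᵖ H²ᵖ(X(ℂ); ℂ)`); the BRIDGE `IsClassical.hodgeConjectureFor`:
  `(∀ p, B.HodgeConjectureFor hX p) → HodgeTheory.HodgeConjectureFor n X` for classical `B`, given a
  Hodge model of `X` (named fact `HodgeTheory.nonempty_hodgeModel`) — support item `ClassicalBridge`
  of `PeriodsPolice`; `PeriodRealization.IsClassical.hodgeConjectureFor` is its form for `X₀ ×_σ ℂ`.

## Scope — what v1 pins and what it does NOT

* PINNED: `B.hodge` (pieces on `p + q = i`, `p, q ≥ 0`, and `Fʳ`, `r ≥ 0`; the three exotic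
  re-decorations violate (i) as soon as one off-diagonal Hodge number of some `X` is non-zero);
  supports of prime-cycle classes; trace and cycle classes as fundamental-class data UP TO the
  orientations packaged in `BettiCycleData` (its `orientation` field is data: the complex orientation
  is not constructed in the tree, cf. `HodgeTheory.OrientationFamily`).
* NOT PINNED (request: "minimal acceptable first version: (i) + (ii)"): clause (iii) — `P.dR` is
  algebraic de Rham cohomology with its Hodge filtration (Grothendieck 1966) and `P.iso σ` is
  Grothendieck's comparison (integration / GAGA): the tree constructs neither (`DeRhamRealization`
  is itself a hypothesis structure), so no honest clause exists today; `P.iso_fil` does transport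
  the pin (i) of the Hodge filtration to `P.dR.fil ⊗_{k,σ} ℂ`. Nor the Tate-rescaling / sign gauge
  `cl ↦ λᵖ cl`, `tr ↦ λ⁻ⁿ tr` of the Weil data, invisible to (i)–(ii).
* `comap` (preimage), not `map`: for the classical datum `Φ_A` is an isomorphism (universal
  coefficients, Hatcher Thm. 3.2 / §3.A; `X^an → X(ℂ)` a homeomorphism, Serre GAGA §2), so both say
  the same; `comap` is the form consumed (membership transfer both ways), `map_piece_le_hodgePQ`
  records the image inclusion (with the axioms of `HodgeStructure`, (i') at `r = 0, i + 1` entails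
  `ker Φ_A = F^{i+1} = ⊥`, a true instance of universal coefficients — nothing false is entailed).
  `∀ A : HodgeModel n X` as requested: all Hodge models give the same `H^{p,q}` on `X(ℂ)` (module
  docstring of `HodgeTheory/RationalHodgeClasses`); `IsOfHodgeType` quantifies `∃ A`.
* No instance is constructed here or anywhere in the tree: exhibiting the classical datum is the
  separate construction item (`∃ P, P.IsClassical`); consumers state `∀ P, P.IsClassical → …`.

## References

* C. Voisin, *Hodge Theory and Complex Algebraic Geometry I*, CUP 2002, §6.1.3 (Prop. 6.11,
  Cor. 6.12), §7.1.1 (Def. 7.4, Prop. 7.5), §11.1.2 (`[Z] = j_Z(T⁻¹(1))`), Prop. 11.20.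
* P. Deligne, *The Hodge conjecture*, Clay (2000), §1.  * W. Fulton, *Intersection Theory* (1998),
  §19.1.  * A. Hatcher, *Algebraic Topology* (2002), §3.1 p. 198, Thm. 3.2, §3.3.  * J.-P. Serre,
  *GAGA* (1956), §2.  * A. Grothendieck, *On the de Rham cohomology of algebraic varieties* (1966).
-/

open CategoryTheory AlgebraicGeometry Opposite
open scoped TensorProduct

noncomputable section

universe u

namespace Literature.AlgebraicGeometry.Motives

open Literature.AlgebraicTopology.SingularHomology Literature.AlgebraicGeometry.HodgeTheory

/-! ### The complexification `ℂ ⊗_ℚ Hᵏ(Y; ℚ) → Hᵏ(Y; ℂ)` of the rational lattice -/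

section OfRat

variable (Y : Type u) [TopologicalSpace Y] (k : ℕ)

/-- The rational lattice map is `ℚ`-homogeneous: `(q • a) ⊗ 1 = q • (a ⊗ 1)` in `Hᵏ(Y; ℂ)`
(change of coefficients along the ring map `ℚ ↪ ℂ`). [cite: HatcherAT2002, §3.1 p. 198] -/
theorem ofRatClass_smul (q : ℚ) (a : singularCohomology ℚ ℚ Y k) :
    ofRatClass Y k (q • a) = (q : ℂ) • ofRatClass Y k a := by
  rw [ofRatClass, coeffClass_smul, smul_coeffClass]
  exact coeffClass_congr (fun x ↦ by simp) a

variable {Y} in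
/-- The rational lattice map is natural in the space: `(f^* a) ⊗ 1 = f^* (a ⊗ 1)`
(Hatcher 2002, §3.1 p. 198). [cite: HatcherAT2002, §3.1 p. 198] -/
theorem ofRatClass_map {Y' : Type u} [TopologicalSpace Y'] (f : C(Y', Y))
    (a : singularCohomology ℚ ℚ Y k) :
    ofRatClass Y' k (singularCohomology.map ℚ ℚ f k a) =
      singularCohomology.map ℂ ℂ f k (ofRatClass Y k a) :=
  coeffClass_map _ f a

/-- The `ℤ`-bilinear map `(c, a) ↦ c • (a ⊗ 1)`, `ℂ × Hᵏ(Y; ℚ) → Hᵏ(Y; ℂ)`, bundled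
(auxiliary for `ofRatClassBaseChange`). [folklore] -/
def smulOfRatClassHom : ℂ →+ singularCohomology ℚ ℚ Y k →+ singularCohomology ℂ ℂ Y k :=
  ((smulAddHom ℂ (singularCohomology ℂ ℂ Y k)).flip.comp (ofRatClass Y k)).flip

/-- `smulOfRatClassHom c a = c • (a ⊗ 1)`. [folklore] -/
@[simp]
theorem smulOfRatClassHom_apply (c : ℂ) (a : singularCohomology ℚ ℚ Y k) :
    smulOfRatClassHom Y k c a = c • ofRatClass Y k a := rfl

/-- **Complexification of the rational lattice** `ℂ ⊗_ℚ Hᵏ(Y; ℚ) →ₗ[ℂ] Hᵏ(Y; ℂ)`,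
`c ⊗ a ↦ c • (a ⊗ 1)`: the `ℂ`-linear extension of the change of coefficients
`HodgeTheory.ofRatClass` (Hatcher 2002, §3.1 p. 198; an isomorphism when `H_•(Y)` is finitely
generated, §3.A — not used). Via `TensorProduct.liftAddHom` (`Hᵏ(Y; ℂ)` has no `Module ℚ`
instance). [cite: HatcherAT2002, §3.1 p. 198] -/
def ofRatClassBaseChange :
    ℂ ⊗[ℚ] singularCohomology ℚ ℚ Y k →ₗ[ℂ] singularCohomology ℂ ℂ Y k where
  toFun := TensorProduct.liftAddHom (smulOfRatClassHom Y k) fun q c a ↦ by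
    rw [smulOfRatClassHom_apply, smulOfRatClassHom_apply, ofRatClass_smul, smul_smul,
      Algebra.smul_def, eq_ratCast, mul_comm]
  map_add' x y := map_add _ x y
  map_smul' c x := by
    induction x using TensorProduct.induction_on with
    | zero => rw [smul_zero, map_zero, RingHom.id_apply, smul_zero]
    | tmul c' a =>
      rw [TensorProduct.smul_tmul', TensorProduct.liftAddHom_tmul, TensorProduct.liftAddHom_tmul,
        RingHom.id_apply, smulOfRatClassHom_apply, smulOfRatClassHom_apply, smul_eq_mul, mul_smul]
    | add x y hx hy => rw [smul_add, map_add, hx, hy, map_add, smul_add]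

/-- `ofRatClassBaseChange (c ⊗ a) = c • (a ⊗ 1)`. [folklore] -/
@[simp]
theorem ofRatClassBaseChange_tmul (c : ℂ) (a : singularCohomology ℚ ℚ Y k) :
    ofRatClassBaseChange Y k (c ⊗ₜ a) = c • ofRatClass Y k a := by
  simp only [ofRatClassBaseChange, LinearMap.coe_mk, AddHom.coe_mk]
  rw [TensorProduct.liftAddHom_tmul, smulOfRatClassHom_apply]

end OfRat

/-! ### The comparison `ℂ ⊗_ℚ Hⁱ(X) → Hⁱ(X(ℂ); ℂ)` of a Betti–Hodge datum -/

namespace BettiHodgeData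

section Comparison

variable {k : Type} [Field k] [Algebra k ℂ] (B : BettiHodgeData k) (X : SchemeOver k) (i : ℕ)

/-- The **complex comparison** of a Betti–Hodge datum: `ℂ ⊗_ℚ Hⁱ(X) →ₗ[ℂ] Hⁱ(X(ℂ); ℂ)`, the
composite of `B.iso ⊗ ℂ : ℂ ⊗_ℚ Hⁱ(X) ≅ ℂ ⊗_ℚ Hⁱ(X(ℂ); ℚ)` and the complexification of the rational
lattice `ofRatClassBaseChange` (Voisin I, §7.1.1: `H^k(X, ℂ) = H^k(X, ℤ) ⊗ ℂ`; Hatcher §3.1).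
[cite: VoisinHodgeI2002, §7.1.1] -/
def complexComparison :
    ℂ ⊗[ℚ] B.W.obj X i →ₗ[ℂ] singularCohomology ℂ ℂ (ComplexPoints X) i :=
  ofRatClassBaseChange (ComplexPoints X) i ∘ₗ (B.isoObj X i).toLinearMap.baseChange ℂ

/-- `B.complexComparison X i (c ⊗ v) = c • (B.iso v ⊗ 1)`. [folklore] -/
@[simp]
theorem complexComparison_tmul (c : ℂ) (v : B.W.obj X i) :
    B.complexComparison X i (c ⊗ₜ v) = c • ofRatClass (ComplexPoints X) i (B.isoObj X i v) := by
  simp [complexComparison]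

end Comparison

variable (B : BettiHodgeData ℂ) {n : ℕ} {X : SchemeOver ℂ}

/-- The **comparison with a Hodge model** `A` of `X`:
`Φ_A : ℂ ⊗_ℚ Hⁱ(X) → Hⁱ(X(ℂ); ℂ) → Hⁱ(X^an; ℂ)`, the complex comparison followed by the pull-back
along the analytification map `X^an → X(ℂ)` (a homeomorphism, Serre GAGA §2; `HodgeModel.pullback`).
[cite: SerreGAGA1956, §2] -/
def hodgeModelComparison (A : HodgeModel n X) (i : ℕ) :
    ℂ ⊗[ℚ] B.W.obj X i →ₗ[ℂ] singularCohomology ℂ ℂ A.carrier i :=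
  (A.pullback i).hom ∘ₗ B.complexComparison X i

/-- `Φ_A (c ⊗ v) = c • φ^*(B.iso v ⊗ 1)`. [folklore] -/
@[simp]
theorem hodgeModelComparison_tmul (A : HodgeModel n X) (i : ℕ) (c : ℂ) (v : B.W.obj X i) :
    B.hodgeModelComparison A i (c ⊗ₜ v) =
      c • A.pullback i (ofRatClass (ComplexPoints X) i (B.isoObj X i v)) := by
  rw [hodgeModelComparison, LinearMap.comp_apply, complexComparison_tmul, map_smul]

/-- On rational vectors: `Φ_A (1 ⊗ v) = φ^*(B.iso v ⊗ 1)`. [folklore] -/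
theorem hodgeModelComparison_ofRat (A : HodgeModel n X) (i : ℕ) (v : B.W.obj X i) :
    B.hodgeModelComparison A i (HodgeStructure.ofRat v) =
      A.pullback i (ofRatClass (ComplexPoints X) i (B.isoObj X i v)) := by
  rw [HodgeStructure.ofRat_apply, hodgeModelComparison_tmul, one_smul]

/-! ### The predicate -/

/-- **`B` is the classical Betti–Hodge realization datum** (hypothesis predicate, v1 = clauses
(i)+(ii) of the request; module docstring for what is and is not pinned): (i)/(i') for every smooth
projective `X`, every Hodge model `A` of `X`, the Hodge pieces `V^{p,q}` (`p + q = i`) and the Hodge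
filtration `Fʳ` of `B.hodge hX i` on `Hⁱ(X) ≅ Hⁱ(X(ℂ); ℚ)` are the preimages of `H^{p,q}(X^an)` and
`Fʳ Hⁱ(X^an)` under `Φ_A : ℂ ⊗_ℚ Hⁱ(X) → Hⁱ(X^an; ℂ)` — `B.hodge` IS the Hodge structure of the
compact Kähler manifold `X^an` (Voisin I, §6.1.3 Prop. 6.11, §7.1.1 Def. 7.4; Deligne 2000, §1);
(ii-a) the Betti class of a prime cycle `z̄` of codimension `p` vanishes on `(X ∖ z̄)(ℂ)` (it comes
from `H²ᵖ(X, X ∖ z̄)`: Voisin I, §11.1.2; Fulton 1998, §19.1); (ii-b) `B` extends to a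
`BettiCycleData` (integral structure, orientations with `tr_X = ⟨–, [X(ℂ)]⟩`, integral cycle
classes). No instance exists in the tree; bridge facts are stated as `B.IsClassical → …`.
[cite: VoisinHodgeI2002, §7.1.1 Def. 7.4 and §11.1.2] -/
structure IsClassical (B : BettiHodgeData ℂ) : Prop where
  /-- (i) The Hodge pieces of `B.hodge hX i` are the preimages of the `H^{p,q}(X^an)` of every Hodge
  model under `Φ_A` (Voisin I, §6.1.3 Prop. 6.11 and §7.1.1 Def. 7.4). -/
  comap_hodgePQ : ∀ ⦃n : ℕ⦄ ⦃X : SchemeOver ℂ⦄ (hX : IsSmoothProjective n X) (A : HodgeModel n X)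
    ⦃i p q : ℕ⦄, p + q = i →
      (A.hodgePQ i p q).comap (B.hodgeModelComparison A i) = (B.hodge hX i).piece p q
  /-- (i') The Hodge filtration of `B.hodge hX i` is the preimage of `Fʳ Hⁱ(X^an) = ⊕_{p ≥ r} H^{p,i-p}`
  of every Hodge model under `Φ_A` (Voisin I, §7.1.1 Def. 7.4 and Prop. 7.5). -/
  comap_hodgeFiltration : ∀ ⦃n : ℕ⦄ ⦃X : SchemeOver ℂ⦄ (hX : IsSmoothProjective n X)
    (A : HodgeModel n X) (i r : ℕ),
      (A.hodgeFiltration i r).comap (B.hodgeModelComparison A i) = (B.hodge hX i).F r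
  /-- (ii-a) The Betti class of the prime cycle `z̄`, `codim z = p`, on a smooth projective `X`
  vanishes on `(X ∖ z̄)(ℂ)` (Voisin I, §11.1.2: `[Z] = j_Z(T⁻¹(1))` comes from `H^{2p}(X, X ∖ Z)`). -/
  restrictCompl_cycleClass : ∀ ⦃n : ℕ⦄ ⦃X : SchemeOver ℂ⦄ (_hX : IsSmoothProjective n X) (p : ℕ)
    (z : X.left), Order.coheight z = p →
      bettiCohomology.restrictCompl X (closure {z}) (2 * p) (B.isoObj X (2 * p) (B.W.cycleClass X p z))
        = 0
  /-- (ii-b) `B` extends to Betti cycle-class data: integral structure, orientations with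
  `tr_X = ⟨–, [X(ℂ)]⟩`, integral cycle classes with `cl_ℤ[Z] ⌢ [X(ℂ)] = ι_*[Z(ℂ)]`
  (Voisin I, §11.1.2; Fulton §19.1). -/
  exists_bettiCycleData : ∃ D : BettiCycleData, D.toBettiHodgeData = B

namespace IsClassical

variable {B}

/-- Membership form of (i): `x ∈ V^{p,q} ↔ Φ_A x ∈ H^{p,q}(X^an)`. [cite: VoisinHodgeI2002, §7.1.1 Def. 7.4] -/
theorem mem_piece_iff (h : B.IsClassical) (hX : IsSmoothProjective n X) (A : HodgeModel n X)
    {i p q : ℕ} (hpq : p + q = i) (x : ℂ ⊗[ℚ] B.W.obj X i) :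
    x ∈ (B.hodge hX i).piece p q ↔ B.hodgeModelComparison A i x ∈ A.hodgePQ i p q := by
  rw [← h.comap_hodgePQ hX A hpq, Submodule.mem_comap]

/-- Membership form of (i'): `x ∈ Fʳ ↔ Φ_A x ∈ Fʳ Hⁱ(X^an)`. [cite: VoisinHodgeI2002, §7.1.1 Def. 7.4] -/
theorem mem_F_iff (h : B.IsClassical) (hX : IsSmoothProjective n X) (A : HodgeModel n X) (i r : ℕ)
    (x : ℂ ⊗[ℚ] B.W.obj X i) :
    x ∈ (B.hodge hX i).F r ↔ B.hodgeModelComparison A i x ∈ A.hodgeFiltration i r := by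
  rw [← h.comap_hodgeFiltration hX A i r, Submodule.mem_comap]

/-- Image form of (i): `Φ_A (V^{p,q}) ⊆ H^{p,q}(X^an)`. [cite: VoisinHodgeI2002, §7.1.1 Def. 7.4] -/
theorem map_piece_le_hodgePQ (h : B.IsClassical) (hX : IsSmoothProjective n X) (A : HodgeModel n X)
    {i p q : ℕ} (hpq : p + q = i) :
    ((B.hodge hX i).piece p q).map (B.hodgeModelComparison A i) ≤ A.hodgePQ i p q := by
  rw [Submodule.map_le_iff_le_comap, h.comap_hodgePQ hX A hpq]

/-- A rational vector `v ∈ Hⁱ(X)` lies in `V^{p,q}` iff its Betti class is of Hodge type `(p, q)` in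
the Hodge model `A`. [cite: VoisinHodgeI2002, §7.1.1] -/
theorem ofRat_mem_piece_iff (h : B.IsClassical) (hX : IsSmoothProjective n X) (A : HodgeModel n X)
    {i p q : ℕ} (hpq : p + q = i) (v : B.W.obj X i) :
    HodgeStructure.ofRat v ∈ (B.hodge hX i).piece p q ↔
      A.pullback i (ofRatClass (ComplexPoints X) i (B.isoObj X i v)) ∈ A.hodgePQ i p q := by
  rw [h.mem_piece_iff hX A hpq, hodgeModelComparison_ofRat]

/-- **The Hodge classes of a classical datum are the rational `(p,p)`-classes of the real carrier**:
`v ∈ Hdgᵖ(B, X) = Hⁱ(X) ∩ Fᵖ` (`i = 2p`) iff the class `B.iso v ⊗ 1 ∈ H²ᵖ(X(ℂ); ℂ)` is of Hodge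
type `(p, p)` (`HodgeTheory.IsOfHodgeType`, through some / any Hodge model). Needs a Hodge model to
exist (`hA`; the tree's named fact `HodgeTheory.nonempty_hodgeModel`). Deligne 2000, §1: "Hodge
classes … `H²ᵖ(X, ℚ) ∩ H^{p,p}(X) = H²ᵖ(X, ℚ) ∩ Fᵖ`". [cite: Deligne2000, §1] -/
theorem mem_hodgeClasses_iff_isOfHodgeType (h : B.IsClassical) (hX : IsSmoothProjective n X)
    (hA : Nonempty (HodgeModel n X)) (p : ℕ) (v : B.W.obj X (2 * p)) :
    v ∈ (B.hodge hX (2 * p)).hodgeClasses p ↔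
      IsOfHodgeType n X (2 * p) p p (ofRatClass (ComplexPoints X) (2 * p) (B.isoObj X (2 * p) v)) := by
  have h2 : (p : ℤ) + p = ((2 * p : ℕ) : ℤ) := by push_cast; ring
  constructor
  · intro hv
    obtain ⟨A⟩ := hA
    exact ⟨A, (h.ofRat_mem_piece_iff hX A (two_mul p).symm v).1
      ((B.hodge hX (2 * p)).ofRat_mem_piece_of_mem_hodgeClasses h2 hv)⟩
  · rintro ⟨A, hA'⟩
    rw [HodgeStructure.mem_hodgeClasses_iff]
    exact (B.hodge hX (2 * p)).piece_le_F p p ((h.ofRat_mem_piece_iff hX A (two_mul p).symm v).2 hA')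

/-- Filtration form: `v ∈ Hⁱ(X) ∩ Fʳ` (`(B.hodge hX i).hodgeClasses r`) iff the class
`B.iso v ⊗ 1 ∈ Hⁱ(X(ℂ); ℂ)` lies in `Fʳ` of some / any Hodge model (`HodgeTheory.IsInHodgeFiltration`),
given a Hodge model (`hA`). Deligne 2000, §1: `H²ᵖ(X, ℚ) ∩ Fᵖ`. [cite: Deligne2000, §1] -/
theorem mem_hodgeClasses_iff_isInHodgeFiltration (h : B.IsClassical) (hX : IsSmoothProjective n X)
    (hA : Nonempty (HodgeModel n X)) (i r : ℕ) (v : B.W.obj X i) :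
    v ∈ (B.hodge hX i).hodgeClasses r ↔
      IsInHodgeFiltration n X i r (ofRatClass (ComplexPoints X) i (B.isoObj X i v)) := by
  rw [HodgeStructure.mem_hodgeClasses_iff]
  constructor
  · intro hv
    obtain ⟨A⟩ := hA
    exact ⟨A, by rw [← hodgeModelComparison_ofRat, ← h.mem_F_iff hX A i r]; exact hv⟩
  · rintro ⟨A, hA'⟩
    rw [h.mem_F_iff hX A i r, hodgeModelComparison_ofRat]
    exact hA'

/-- **Betti cycle classes of a classical datum are algebraic classes on the real carrier**: for a
point `z` of codimension `p` on a smooth projective `X`, `B.iso (cl(z̄)) ⊗ 1 ∈ Nᵖ H²ᵖ(X(ℂ); ℂ) =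
HodgeTheory.algebraicClasses X p` (from (ii-a): it dies on `(X ∖ z̄)(ℂ)`, and every point of `z̄`
has codimension `≥ p`; Voisin I, §11.1.2; Fulton §19.1). [cite: VoisinHodgeI2002, §11.1.2] -/
theorem ofRatClass_isoObj_cycleClass_mem (h : B.IsClassical) (hX : IsSmoothProjective n X) {p : ℕ}
    {z : X.left} (hz : Order.coheight z = p) :
    ofRatClass (ComplexPoints X) (2 * p) (B.isoObj X (2 * p) (B.W.cycleClass X p z)) ∈
      algebraicClasses X p := by
  refine mem_supportedClasses_of_restrictCompl_eq_zero (Z := closure {z}) isClosed_closure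
    (fun z' hz' ↦ ?_) ?_
  · rw [← hz]
    exact Order.coheight_anti (Scheme.le_iff_specializes.2 (specializes_iff_mem_closure.2 hz'))
  · change singularCohomology.map ℂ ℂ _ (2 * p) (ofRatClass _ _ _) = 0
    rw [← ofRatClass_map, h.restrictCompl_cycleClass hX p z hz, map_zero]

/-- Hence the whole `ℚ`-span of cycle classes maps into the algebraic classes of the real carrier:
`v ∈ ℚ · Aᵖ(X)` implies `B.iso v ⊗ 1 ∈ HodgeTheory.algebraicClasses X p`. [cite: VoisinHodgeI2002, §11.1.2] -/
theorem ofRatClass_isoObj_mem_algebraicClasses (h : B.IsClassical) (hX : IsSmoothProjective n X)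
    {p : ℕ} {v : B.W.obj X (2 * p)} (hv : v ∈ B.W.algebraicClasses X p) :
    ofRatClass (ComplexPoints X) (2 * p) (B.isoObj X (2 * p) v) ∈ algebraicClasses X p := by
  induction hv using Submodule.span_induction with
  | mem x hx =>
    rw [SetLike.mem_coe] at hx
    unfold PreWeilCohomology.algebraicLattice at hx
    induction hx using AddSubgroup.closure_induction with
    | mem y hy =>
      obtain ⟨⟨z, hz⟩, rfl⟩ := hy
      exact h.ofRatClass_isoObj_cycleClass_mem hX hz
    | zero => rw [map_zero, map_zero]; exact zero_mem _
    | add x y _ _ hx hy => rw [map_add, map_add]; exact add_mem hx hy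
    | neg x _ hx => rw [map_neg, map_neg]; exact neg_mem hx
  | zero => rw [map_zero, map_zero]; exact zero_mem _
  | add x y _ _ hx hy => rw [map_add, map_add]; exact add_mem hx hy
  | smul q x _ hx =>
    rw [map_smul, ofRatClass_smul]
    exact Submodule.smul_mem _ _ hx

/-- **Bridge (support item `ClassicalBridge` of route `HodgeConjecture/PeriodsPolice`).** For the
classical Betti–Hodge datum, the `B`-relative Hodge conjecture for `X` (`B.HodgeConjectureFor hX p`:
`ℚ · Aᵖ(X) = Hdgᵖ(X)`, all `p`) implies the Hodge conjecture for `X` on the real carriers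
(`HodgeTheory.HodgeConjectureFor n X`: rational `(p,p)`-classes of `H²ᵖ(X(ℂ); ℂ)` are algebraic),
given a Hodge model of `X` (`hA`, the tree's named fact `HodgeTheory.nonempty_hodgeModel`; Serre
GAGA + de Rham + Hodge). Proof: a rational class is `B.iso v ⊗ 1`; of type `(p,p)` means
`v ∈ Hdgᵖ` by (i); `= ℚ · Aᵖ(X)` by hypothesis; its image is algebraic by (ii-a).
[cite: Deligne2000, §1] -/
theorem hodgeConjectureFor (h : B.IsClassical) (hX : IsSmoothProjective n X)
    (hA : Nonempty (HodgeModel n X)) (hHC : ∀ p : ℕ, B.HodgeConjectureFor hX p) :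
    HodgeTheory.HodgeConjectureFor n X := by
  refine ⟨hA, fun p c hc hpp ↦ ?_⟩
  obtain ⟨a, rfl⟩ := (isRationalClass_iff_mem_range_ofRatClass c).1 hc
  obtain ⟨v, rfl⟩ : ∃ v, B.isoObj X (2 * p) v = a :=
    ⟨(B.isoObj X (2 * p)).symm a, LinearEquiv.apply_symm_apply _ _⟩
  have hv : v ∈ (B.hodge hX (2 * p)).hodgeClasses p :=
    (h.mem_hodgeClasses_iff_isOfHodgeType hX hA p v).2 hpp
  rw [← hHC p] at hv
  exact h.ofRatClass_isoObj_mem_algebraicClasses hX hv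

end IsClassical

end BettiHodgeData

/-! ### Classical period realizations -/

namespace PeriodRealization

variable {k : Type} [Field k] [CharZero k]

/-- **`P` is the classical period realization** (hypothesis predicate, v1): its Betti–Hodge datum
`P.B` is the classical one (`BettiHodgeData.IsClassical`: Hodge structures = Hodge decomposition of
`X^an`, cycle classes supported on their cycles, fundamental-class data). Clause (iii) of the request
— `P.dR` = algebraic de Rham cohomology with its Hodge filtration (Grothendieck 1966, Thm. 1') and
`P.iso σ` = Grothendieck's comparison isomorphism — is NOT part of v1: the tree has no construction
of either to compare against (module docstring, "Scope"). Consumers (route `PeriodsPolice`) state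
`∀ P, P.IsClassical → …`; the classical instance `∃ P, P.IsClassical` is a separate construction item.
[cite: Grothendieck1966, Thm. 1'] -/
structure IsClassical (P : PeriodRealization k) : Prop where
  /-- The Betti–Hodge datum of `P` is classical. -/
  betti : P.B.IsClassical

/-- **Bridge for `k`-definable varieties** (the form requested by `ClassicalBridge`, `k = ℚ̄`): for a
classical period realization, an embedding `σ : k →+* ℂ` and `X₀/k` with `X = X₀ ×_σ ℂ` smooth
projective of dimension `n`, the `P.B`-relative Hodge conjecture for `X` (all `p`) implies
`HodgeTheory.HodgeConjectureFor n X`, given a Hodge model of `X`. [cite: Deligne2000, §1] -/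
theorem IsClassical.hodgeConjectureFor {P : PeriodRealization k} (h : P.IsClassical) (σ : k →+* ℂ)
    {n : ℕ} {X₀ : SchemeOver k} (hX : IsSmoothProjective n ((baseChangeHom σ).obj X₀))
    (hA : Nonempty (HodgeModel n ((baseChangeHom σ).obj X₀)))
    (hHC : ∀ p : ℕ, P.B.HodgeConjectureFor hX p) :
    HodgeTheory.HodgeConjectureFor n ((baseChangeHom σ).obj X₀) :=
  h.betti.hodgeConjectureFor hX hA hHC

end PeriodRealization

/-! ### Appended (v2): the light-weight pin `BettiHodgeData.IsClassicalHodge`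

`Motives/BettiHodgeClassicalPin` (definition request `defn-BettiHodgeData.IsClassicalHodge`) is the
light-weight home of clauses (i)/(i') — the Hodge-structure pin — stated with the comparison maps
`ringChangeBaseChange`, `BettiHodgeData.comparison`, `BettiHodgeData.modelComparison` built on the
fact-free change of coefficients `singularCohomology.ringChange (ℚ ↪ ℂ)` instead of `ofRatClass`.
The two change-of-coefficient maps agree DEFINITIONALLY (`[ζ] ↦ [σ ↦ (ζ σ : ℂ)]` either way), so the
comparison maps of this file and of the pin file are equal by `rfl`, `IsClassical` projects onto
`IsClassicalHodge` by the identity on its first two fields, and conversely the pin plus (ii-a),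
(ii-b) is `IsClassical`. Routes whose cruxes only read `B.hodge` as THE Hodge structure
(`HodgeConjecture/PeriodDeficiency`, `PeriodsPolice`) can therefore assume `B.IsClassicalHodge`
and import the pin file alone. -/

section PinBridge

variable (Y : Type u) [TopologicalSpace Y] (k : ℕ)

/-- The two complexified change-of-coefficient maps `ℂ ⊗_ℚ Hᵏ(Y; ℚ) → Hᵏ(Y; ℂ)` of the tree agree:
`ofRatClassBaseChange` (`ofRatClass` spelling, this file) `=` `ringChangeBaseChange`
(`singularCohomology.ringChange (ℚ ↪ ℂ)` spelling, `Motives/BettiHodgeClassicalPin`) — both send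
`c ⊗ [ζ]` to `c • [σ ↦ (ζ σ : ℂ)]`, definitionally. [cite: HatcherAT2002, §3.1 p. 198] -/
theorem ofRatClassBaseChange_eq_ringChangeBaseChange :
    ofRatClassBaseChange Y k = ringChangeBaseChange Y k :=
  rfl

end PinBridge

namespace BettiHodgeData

/-- `B.complexComparison = B.comparison`: the comparison `ℂ ⊗_ℚ Hⁱ(X) → Hⁱ(X(ℂ); ℂ)` in the
`ofRatClass` spelling (this file) is, definitionally, the one in the `ringChange` spelling
(`Motives/BettiHodgeClassicalPin`). [folklore] -/
theorem complexComparison_eq_comparison {k : Type} [Field k] [Algebra k ℂ] (B : BettiHodgeData k)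
    (X : SchemeOver k) (i : ℕ) : B.complexComparison X i = B.comparison X i :=
  rfl

variable {B : BettiHodgeData ℂ} {n : ℕ} {X : SchemeOver ℂ}

variable (B) in
/-- `Φ_A`: `B.hodgeModelComparison A i = B.modelComparison A i`, definitionally (the `ofRatClass`
and the `ringChange` spellings of the comparison with a Hodge model agree). [folklore] -/
theorem hodgeModelComparison_eq_modelComparison (A : HodgeModel n X) (i : ℕ) :
    B.hodgeModelComparison A i = B.modelComparison A i :=
  rfl

/-- **Projection onto the pin**: a classical Betti–Hodge datum satisfies the Hodge-structure pin
`IsClassicalHodge` (`Motives/BettiHodgeClassicalPin`) — its clauses (i)/(i') ARE the two clauses of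
the pin, up to the definitional equality `hodgeModelComparison = modelComparison`.
[cite: VoisinHodgeI2002, §7.1.1 Def. 7.4] -/
theorem IsClassical.isClassicalHodge (h : B.IsClassical) : B.IsClassicalHodge :=
  ⟨h.comap_hodgePQ, h.comap_hodgeFiltration⟩

/-- Conversely, the pin together with clauses (ii-a) (Betti classes of prime cycles die off their
cycles) and (ii-b) (extension to Betti cycle-class data) is `IsClassical`.
[cite: VoisinHodgeI2002, §7.1.1 and §11.1.2] -/
theorem IsClassical.of_isClassicalHodge (h : B.IsClassicalHodge)
    (h₂ : ∀ ⦃n : ℕ⦄ ⦃X : SchemeOver ℂ⦄ (_hX : IsSmoothProjective n X) (p : ℕ) (z : X.left),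
      Order.coheight z = p →
        bettiCohomology.restrictCompl X (closure {z}) (2 * p)
          (B.isoObj X (2 * p) (B.W.cycleClass X p z)) = 0)
    (h₃ : ∃ D : BettiCycleData, D.toBettiHodgeData = B) : B.IsClassical :=
  ⟨h.comap_hodgePQ, h.comap_hodgeFiltration, h₂, h₃⟩

variable (B) in
/-- `IsClassical ↔ IsClassicalHodge ∧ (ii-a) ∧ (ii-b)`: the full predicate is the pin plus the two
cycle-class clauses. [folklore] -/
theorem isClassical_iff_isClassicalHodge :
    B.IsClassical ↔ B.IsClassicalHodge ∧
      (∀ ⦃n : ℕ⦄ ⦃X : SchemeOver ℂ⦄ (_hX : IsSmoothProjective n X) (p : ℕ) (z : X.left),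
        Order.coheight z = p →
          bettiCohomology.restrictCompl X (closure {z}) (2 * p)
            (B.isoObj X (2 * p) (B.W.cycleClass X p z)) = 0) ∧
      ∃ D : BettiCycleData, D.toBettiHodgeData = B :=
  ⟨fun h ↦ ⟨h.isClassicalHodge, h.restrictCompl_cycleClass, h.exists_bettiCycleData⟩,
    fun ⟨h₁, h₂, h₃⟩ ↦ IsClassical.of_isClassicalHodge h₁ h₂ h₃⟩

/-- The pinned Hodge classes in the `ofRatClass` spelling, from the pin alone (same statement as
`IsClassical.mem_hodgeClasses_iff_isOfHodgeType` under the weaker hypothesis; definitionally the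
pin file's `IsClassicalHodge.mem_hodgeClasses_iff_isOfHodgeType`). [cite: Deligne2000, §1] -/
theorem IsClassicalHodge.mem_hodgeClasses_iff_isOfHodgeType_ofRatClass (h : B.IsClassicalHodge)
    (hX : IsSmoothProjective n X) (hA : Nonempty (HodgeModel n X)) (p : ℕ)
    (v : B.W.obj X (2 * p)) :
    v ∈ (B.hodge hX (2 * p)).hodgeClasses p ↔
      IsOfHodgeType n X (2 * p) p p
        (ofRatClass (ComplexPoints X) (2 * p) (B.isoObj X (2 * p) v)) :=
  h.mem_hodgeClasses_iff_isOfHodgeType hX hA p v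

/-- Filtration form in the `ofRatClass` spelling, from the pin alone (same statement as
`IsClassical.mem_hodgeClasses_iff_isInHodgeFiltration` under the weaker hypothesis).
[cite: Deligne2000, §1] -/
theorem IsClassicalHodge.mem_hodgeClasses_iff_isInHodgeFiltration_ofRatClass
    (h : B.IsClassicalHodge) (hX : IsSmoothProjective n X) (hA : Nonempty (HodgeModel n X))
    (i r : ℕ) (v : B.W.obj X i) :
    v ∈ (B.hodge hX i).hodgeClasses r ↔
      IsInHodgeFiltration n X i r (ofRatClass (ComplexPoints X) i (B.isoObj X i v)) :=
  h.mem_hodgeClasses_iff_isInHodgeFiltration hX hA i r v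

end BettiHodgeData

/-- A classical period realization satisfies the pin. [folklore] -/
theorem PeriodRealization.IsClassical.isClassicalHodge {k : Type} [Field k] [CharZero k]
    {P : PeriodRealization k} (h : P.IsClassical) : P.B.IsClassicalHodge :=
  h.betti.isClassicalHodge

end Literature.AlgebraicGeometry.Motives

end
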